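import Summits.QuantumFields.BalabanUV.T4Continuum.Support.VariationalVectorFederbushLine

/-!
# T⁴ programme, spine node NE2 (U1a), lane P2 — THE LINE-SUM AVERAGE INTERTWINES THE COVARIANT EXTERIOR DERIVATIVE ON 0-FORMS:
# `Q_{T′∘Π}(D_{R′}λ′) = n⁻¹ • ( D_{Rc}(Q_{T′}λ′) − (mismatch average) )` EXACTLY — pure-gauge fine directions are averaged to pure-gauge coarse
# directions up to FED⁺'s site mismatch (model level, `E`-valued, one block step, every torus)
# (`t4/skeletons/NE2-t4-ne2-p2.md` v0.15 §2.E — structural input of rows V-P ∕ V-GF ∕ V-CURV; cell `pub-balaban`)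

NE2 formalisation swarm `b2b-balaban-t4-ne2-formalise-*`, leaf prover 01 GEN 5 (`prover-b2b-balaban-t4-ne2-formalise-leaf-01-g5-0`); a by-product of the V-FED
line (files 1–4 `VariationalVectorFederbush{,Sum,Phys,Line}` p216586 ∕ p216754 ∕ p217269 ∕ p217357).  On top of `VariationalColourFederbush.cDv_Qcv_eq`
(p214930: the exact decomposition of the coarse covariant difference of the transported SITE average — «one line through one coarse bond») and of file 4's
product line transports `lineT T′ R′ y j t ν = T′(n·y+j) ∘ Π^ν_t(n·y+j)` — BY NAME; no new definition.

THE STATEMENT (model level).  Block side `n`, coarse torus `Tor M`, fine torus `Tor (fine n M)`; an `E`-valued fine 0-form `λ′`; fine bond transports `R′`,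
site transports `T′`, coarse bond transports `Rc` (DATA, continuous linear maps).  The covariant gradient `D_{R′}λ′ : (x, μ) ↦ R′(x,μ)(λ′(x+e_μ)) − λ′(x)`
(`VariationalColourFederbush.cDv`) is an `E`-valued 1-form; its LINE-SUM AVERAGE with the product line transports telescopes along every line
(`line_telescope` ∕ `piTv_telescope`), so
  **`QvL_lineT_cDv_eq`**:  `Q_{T′∘Π}(D_{R′}λ′)(y,μ) = n⁻¹ • ( (D_{Rc} Q_{T′}λ′)(y,μ) − n^{−d} • Σ_j Mis(y,μ,j)(λ′(n·(y+e_μ)+j)) )`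
with `Q_{T′}` the transported site average `VariationalColourFederbush.Qcv` and `Mis = misv Rc R′ T′` FED⁺'s one-block SITE mismatch.  Consequences:
  * `norm_QvL_cDv_sub_le` — `‖Q_{T′∘Π}(D_{R′}λ′)(y,μ) − n⁻¹•(D_{Rc}Q_{T′}λ′)(y,μ)‖ ≤ n⁻¹·n^{−d}·m₀·Σ_j‖λ′(n·(y+e_μ)+j)‖` under `‖misv‖ ≤ m₀`;
  * `sum_sq_QvL_cDv_sub_le` — `Σ_{y,μ} ‖…‖² ≤ d·m₀²·n^{−2}·(Σ_x‖λ′x‖²∕n^d)`;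
  * `QvL_cDv_flat` — at flat data (`Rc = R′ = T′ = 1`) EXACTLY `Q_1(Dλ′) = n⁻¹ • D(Q_1 λ′)`: the line-sum average of [Balaban1984PropagatorsI] (1.18) maps lattice
    gradients to `n⁻¹` × coarse gradients of the block mean (the `d`-commutation «Q d = n⁻¹ d Q₀» of the averaging with the exterior derivative on 0-forms).
WHY (the road's use).  Pure-gauge directions `W = D_{R′}λ′` have zero curl up to curvature; the vector form's gauge∕curvature functional `G` ([B9] (3.26) «D R(U) D*»)
and leaf V-P's coercivity split the fibre into gradient and co-gradient parts — this identity is what carries that splitting through one block step (the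
`Q′* a Q′` structure of (3.24)); it is also the `E`-valued form of the observation `Q(Dλ) = n⁻¹ D(Q₀λ)` used informally in the V-ONE∕V-P design notes.
WHAT IS NOT HERE: V-P, V-GF, any statement about minimisers; the sizes of `m₀`.

HONEST FRAMING (T4-DAG p. 1).  Model level; transports DATA; [folklore] telescoping (a repackaging of `cDv_Qcv_eq`); nothing printed is a hypothesis; no `def`,
no `def … : Prop`, no `sorry`; axioms standard.  NE2 NOT proved; spine PROVED 0∕9 unchanged; rung (B)+1 finite T⁴ — NOT infinite volume, NOT mass gap, NOT Clay.
HONEST DEPENDENCY (cell, verbatim): continuum YM on T⁴ ⇐ BetaPertH ∧ nine spine estimates (0/9 proved); BetaPertH ⇐ (D1) ∧ (D4) ∧ CAP+tail; G-an2-4 gates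
asym, D1 and NE2/3/4.
-/

noncomputable section

namespace Summit.QuantumFields.BalabanUV.T4Continuum.VariationalVectorExterior

open Finset
open Literature.MathematicalPhysics.QuantumFieldTheory.Balaban1983to89
open Literature.MathematicalPhysics.QuantumFieldTheory.Balaban1983to89.B5Prop11Plancherel (Tor fine unitVec)
open Literature.MathematicalPhysics.QuantumFieldTheory.Balaban1983to89.B5Block118 (tstep bpt)
open Summit.QuantumFields.BalabanUV.T4Continuum.VariationalColourFederbush (cDv Qcv piTv misv cDv_Qcv_eq sum_sq_defect_le)
open Summit.QuantumFields.BalabanUV.T4Continuum.VectorBlockTrialForm (QvL)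
open Summit.QuantumFields.BalabanUV.T4Continuum.VariationalVectorFederbush (lineT piTv_one)

variable {d : ℕ} {E : Type*} [NormedAddCommGroup E] [NormedSpace ℂ E]
variable (n : ℕ) [NeZero n] (M : Fin d → ℕ) [hM : ∀ μ, NeZero (M μ)]
variable (Rc : Tor M → Fin d → (E →L[ℂ] E)) (R' : Tor (fine n M) → Fin d → (E →L[ℂ] E)) (T' : Tor (fine n M) → (E →L[ℂ] E))

/-! ## §1 The exact intertwining identity -/

omit hM in
/-- **THE LINE-SUM AVERAGE INTERTWINES THE COVARIANT GRADIENT**: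
`Q_{T′∘Π}(D_{R′}λ′)(y,μ) = n⁻¹ • ( (D_{Rc}Q_{T′}λ′)(y,μ) − n^{−d} • Σ_j Mis(y,μ,j)(λ′(n·(y+e_μ)+j)) )` — every line telescopes to the difference of its end
values; the start value carries `T′`, the end value `T′∘Π_n`, which is `Rc∘T′` of the neighbouring block up to FED⁺'s site mismatch. [folklore] -/
theorem QvL_lineT_cDv_eq (f' : Tor (fine n M) → E) (y : Tor M) (μ : Fin d) :
    QvL n M (lineT n M T' R') (cDv (fine n M) R' f') y μ
      = ((n : ℂ)⁻¹ : ℂ) • (cDv M Rc (Qcv n M T' f') y μ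
          - (((n : ℂ) ^ d)⁻¹ : ℂ) • ∑ j : Fin d → Fin n, misv n M Rc R' T' y μ j (f' (bpt n M (y + unitVec M μ) j))) := by
  have hn : (n : ℂ) ≠ 0 := by exact_mod_cast NeZero.ne n
  rw [cDv_Qcv_eq n M Rc R' T' f' y μ, sum_add_distrib, smul_add, add_sub_cancel_right, smul_smul]
  have hc : ((n : ℂ)⁻¹ : ℂ) * (((n : ℂ) ^ d)⁻¹ : ℂ) = (((n : ℂ) ^ (d + 1))⁻¹ : ℂ) := by
    rw [← mul_inv, pow_succ, mul_comm ((n : ℂ) ^ d)]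
  rw [hc]
  unfold QvL
  congr 1
  refine sum_congr rfl fun j _ => ?_
  rw [map_sum, ← Fin.sum_univ_eq_sum_range]
  rfl

/-! ## §2 The size of the deviation, and the flat identity -/

omit hM in
/-- **POINTWISE**: `‖Q_{T′∘Π}(D_{R′}λ′)(y,μ) − n⁻¹•(D_{Rc}Q_{T′}λ′)(y,μ)‖ ≤ n⁻¹·n^{−d}·m₀·Σ_j‖λ′(n·(y+e_μ)+j)‖` under the site-mismatch bound `‖Mis‖ ≤ m₀`. [folklore] -/
theorem norm_QvL_cDv_sub_le {m₀ : ℝ} (hmis : ∀ y μ j, ‖misv n M Rc R' T' y μ j‖ ≤ m₀) (f' : Tor (fine n M) → E) (y : Tor M) (μ : Fin d) :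
    ‖QvL n M (lineT n M T' R') (cDv (fine n M) R' f') y μ - ((n : ℂ)⁻¹ : ℂ) • cDv M Rc (Qcv n M T' f') y μ‖
      ≤ (n : ℝ)⁻¹ * (((n : ℝ) ^ d)⁻¹ * (m₀ * ∑ j : Fin d → Fin n, ‖f' (bpt n M (y + unitVec M μ) j)‖)) := by
  rw [QvL_lineT_cDv_eq n M Rc R' T', smul_sub, sub_sub_cancel_left, norm_neg, norm_smul, norm_smul, norm_inv, norm_inv, norm_pow,
    Complex.norm_natCast, mul_sum]
  refine mul_le_mul_of_nonneg_left (mul_le_mul_of_nonneg_left ((norm_sum_le _ _).trans (sum_le_sum fun j _ => ?_)) (by positivity))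
    (by positivity)
  exact (ContinuousLinearMap.le_opNorm _ _).trans (mul_le_mul_of_nonneg_right (hmis y μ j) (norm_nonneg _))

/-- **SUMMED**: `Σ_μ Σ_y ‖Q_{T′∘Π}(D_{R′}λ′)(y,μ) − n⁻¹•(D_{Rc}Q_{T′}λ′)(y,μ)‖² ≤ d·m₀²·n⁻²·(Σ_x‖λ′x‖²∕n^d)` — in physical units at coarse level `N` this is
`(N m₀)²∕(N n)²`-small against the fine field's `ℓ²` size: the averaged pure-gauge direction is pure gauge up to a term of the bracket's `δ`-order. [folklore] -/
theorem sum_sq_QvL_cDv_sub_le {m₀ : ℝ} (hmis : ∀ y μ j, ‖misv n M Rc R' T' y μ j‖ ≤ m₀) (f' : Tor (fine n M) → E) :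
    ∑ μ : Fin d, ∑ y : Tor M, ‖QvL n M (lineT n M T' R') (cDv (fine n M) R' f') y μ - ((n : ℂ)⁻¹ : ℂ) • cDv M Rc (Qcv n M T' f') y μ‖ ^ 2
      ≤ d * (m₀ ^ 2 * ((n : ℝ) ^ 2)⁻¹ * ((∑ x, ‖f' x‖ ^ 2) / (n : ℝ) ^ d)) := by
  have hn : (0 : ℝ) < n := by exact_mod_cast Nat.pos_of_ne_zero (NeZero.ne n)
  have hnd : (0 : ℝ) < (n : ℝ) ^ d := by positivity
  have hμ : ∀ μ : Fin d, ∑ y : Tor M, ‖QvL n M (lineT n M T' R') (cDv (fine n M) R' f') y μ - ((n : ℂ)⁻¹ : ℂ) • cDv M Rc (Qcv n M T' f') y μ‖ ^ 2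
      ≤ m₀ ^ 2 * ((n : ℝ) ^ 2)⁻¹ * ((∑ x, ‖f' x‖ ^ 2) / (n : ℝ) ^ d) := by
    intro μ
    have hdef := sum_sq_defect_le n M f' μ
    calc _ ≤ ∑ y : Tor M, ((n : ℝ)⁻¹ * (((n : ℝ) ^ d)⁻¹ * (m₀ * ∑ j : Fin d → Fin n, ‖f' (bpt n M (y + unitVec M μ) j)‖))) ^ 2 :=
          sum_le_sum fun y _ => pow_le_pow_left₀ (norm_nonneg _) (norm_QvL_cDv_sub_le n M Rc R' T' hmis f' y μ) 2
      _ = ((n : ℝ)⁻¹ * ((n : ℝ) ^ d)⁻¹ * m₀) ^ 2 * ∑ y : Tor M, (∑ j : Fin d → Fin n, ‖f' (bpt n M (y + unitVec M μ) j)‖) ^ 2 := by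
          rw [mul_sum]; exact sum_congr rfl fun y _ => by ring
      _ ≤ ((n : ℝ)⁻¹ * ((n : ℝ) ^ d)⁻¹ * m₀) ^ 2 * ((n : ℝ) ^ d * ∑ x, ‖f' x‖ ^ 2) := mul_le_mul_of_nonneg_left hdef (sq_nonneg _)
      _ = _ := by field_simp
  calc _ ≤ ∑ _μ : Fin d, m₀ ^ 2 * ((n : ℝ) ^ 2)⁻¹ * ((∑ x, ‖f' x‖ ^ 2) / (n : ℝ) ^ d) := sum_le_sum fun μ _ => hμ μ
    _ = _ := by rw [sum_const, Finset.card_univ, Fintype.card_fin, nsmul_eq_mul]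

omit [NeZero n] hM in
/-- flat data: FED⁺'s site mismatch vanishes. [folklore] -/
theorem misv_flat (y : Tor M) (μ : Fin d) (j : Fin d → Fin n) :
    misv n M (fun _ _ => (1 : E →L[ℂ] E)) (fun _ _ => 1) (fun _ => 1) y μ j = 0 := by
  simp only [misv, piTv_one, mul_one, sub_self]

omit hM in
/-- **FLAT DATA, EXACTLY**: `Q_1(Dλ′)(y,μ) = n⁻¹ • (D(Q_1λ′))(y,μ)` — the line-sum average of [Balaban1984PropagatorsI] (1.18) maps the lattice gradient of a fine
0-form to `n⁻¹` times the coarse gradient of its block mean (`E`-valued; the identity behind «`Q` commutes with `d` on 0-forms up to the scale factor»). [folklore] -/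
theorem QvL_cDv_flat (f' : Tor (fine n M) → E) (y : Tor M) (μ : Fin d) :
    QvL n M (lineT n M (fun _ => (1 : E →L[ℂ] E)) (fun _ _ => 1)) (cDv (fine n M) (fun _ _ => (1 : E →L[ℂ] E)) f') y μ
      = ((n : ℂ)⁻¹ : ℂ) • cDv M (fun _ _ => (1 : E →L[ℂ] E)) (Qcv n M (fun _ => 1) f') y μ := by
  rw [QvL_lineT_cDv_eq n M (fun _ _ => (1 : E →L[ℂ] E))]
  simp only [misv_flat, zero_apply, sum_const_zero, smul_zero, sub_zero]

end Summit.QuantumFields.BalabanUV.T4Continuum.VariationalVectorExterior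

end
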